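import Summits.RiemannHypothesis.RiemannHypothesis.Theorems.PfPersistenceWindowDanskin
import Summits.RiemannHypothesis.RiemannHypothesis.Theorems.WeilParityEvenWinsBeyondArchTwoThreeWindow
import Summits.RiemannHypothesis.RiemannHypothesis.Theorems.WeilGroundStateGroundStatesConvergeToXiUniqueGroundState
import Summits.RiemannHypothesis.RiemannHypothesis.Theorems.WeilGroundStateMarkovPartPositiveGroundStateLsc
import Summits.RiemannHypothesis.RiemannHypothesis.Theorems.WeilGroundStateMarkovPartPositiveGroundStatePhase
import HarnessLib

/-!
# The window energy of the Weil form is differentiable at EVERY small window: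
# the Hellmann–Feynman edge law without hypotheses (pub-rhpf, theory-1 gen 10; helper for crux
# `EvenSectorBarta.EvenOneSignedWindows`, item stmt-RiemannHypothesis-19953; RH-free)

**mechanism/rigidity campaign; no RH claims.**  Companion text:
`run/shared/lean/pub/pub-rhpf/pub-rhpf-theory-1/THEORY-EDGE-10.md`.

THE EDGE LAW, FINAL FORM ON `(0, ½ log 2)` (all PROVED here; `ε = weilGroundEnergy`,
`V(u) = weilSmallWindowVirial a u` the dilation virial of a ground state `u` of the window `a`):

* `exists_phase_ae_eq_of_isWeilGroundState`: for `0 < a ≤ log 2` two ground states of the window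
  `a` agree a.e. up to a unimodular constant (the bottom is simple: `WeilWindowSimpleEven a` holds
  at every `a ≤ log 2` by the tree theorem `EvenWinsBeyondArch.weilWindowSimpleEven_of_le_log_two`,
  and a simple bottom pins every ground state to the phase orbit of one of them,
  `GroundStatesConvergeToXi.norm_integral_mul_conj_eq_one_of_windowSimpleEven`);
* `weilFormVirial_const_mul`, `weilFormVirial_congr_ae`: the closed virial is a quadratic
  functional (`V(c f) = |c|² V(f)`) depending only on the a.e. class; hence
  `weilSmallWindowVirial_eq_of_isWeilGroundState`: ALL ground states of a window `a ≤ log 2` have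
  the same virial — the hypothesis of Danskin's equality case
  (`hasDerivAt_weilGroundEnergy_of_virial_eq`, `PfPersistenceWindowDanskin`) is DISCHARGED;
* `hasDerivAt_weilGroundEnergy`, `differentiableOn_weilGroundEnergy`,
  `mul_deriv_weilGroundEnergy_eq_neg_virial`: `ε` is differentiable at every `a ∈ (0, ½ log 2)`
  and `a · ε'(a) = −V(u)` for EVERY ground state `u` of `a` — the Hellmann–Feynman / edge law as a
  two-sided derivative, with no differentiability, uniqueness or regularity hypothesis left;
* (sequel `PfPersistenceWindowC1`) the virial of the ground state is a continuous function of
  the window, hence `ε ∈ C¹(0, ½ log 2)`.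

STRUCTURE versus ARITHMETIC.  Everything here is a theorem about ζ's windowed Weil form below the
first prime length (`2a < log 2`: the prime sum does not see the window and the form is
pole term + archimedean Markov part).  The only input beyond the variational structure used in
`PfPersistenceWindowDanskin` is SIMPLICITY OF THE BOTTOM, and for `a ≤ log 2` that is itself a
theorem of the tree obtained from the STRUCTURE of the archimedean part (parity splitting, the
antiderivative intertwiner between the odd sector and the even sector, odd-sector coercivity) —
not from any arithmetic statistic.  Consequently the same smooth edge law holds verbatim for every
"control" form with the same archimedean dressing and no prime below the window: on `(0, ½ log 2)`
the edge law is NOT an invariant distinguishing ζ from its controls (it cannot be: the prime sum is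
invisible there).  What WOULD carry arithmetic is the behaviour of `ε'` ACROSS the prime lengths
`a = ½ log p^k` (the first at `½ log 2`), where the virial acquires the prime-edge terms; that is
not addressed here.

References: T. Kato, *Perturbation Theory for Linear Operators* (1966), II §6.4 (simple
eigenvalues depend smoothly on the parameter), VII §4, VII §6.5; J. M. Danskin, SIAM J. Appl.
Math. 14 (1966) 641–664, Thm 1 and Cor.; A. Connes, W. D. van Suijlekom (2025), Thm 6.1 (the gap
inequality); A. Connes, C. Consani, H. Moscovici (2025), Thm 3.6 (compactness).
-/

set_option linter.dupNamespace false

noncomputable section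

open MeasureTheory Set Filter Metric
open scoped Topology RealInnerProductSpace ComplexConjugate

namespace Summit.RiemannHypothesis.RiemannHypothesis.Theorems.PfPersistence

open Literature.NumberTheory.LFunctions
open Summit.RiemannHypothesis.RiemannHypothesis.Theorems.WeilGroundStateMarkovPart
  (weilIncrement_const_mul weilIncrement_congr_ae)

/-! ## §1 Uniqueness of the ground state up to phase at every window `a ≤ log 2` -/

/-- **Two ground states of a window `0 < a ≤ log 2` agree a.e. up to a unimodular constant.**
The bottom of the window is simple (`EvenWinsBeyondArch.weilWindowSimpleEven_of_le_log_two`), so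
`|⟨v, u⟩| = 1` for unit ground states `u, v`
(`GroundStatesConvergeToXi.norm_integral_mul_conj_eq_one_of_windowSimpleEven`), and the equality
case of Cauchy–Schwarz (`ConnesVanSuijlekom.integral_norm_sq_sub_proj`) gives `v = ⟨v,u⟩ u` a.e.
[cite: ConnesSuijlekom2025, Thm. 6.1 (proof, p. 11)] -/
theorem exists_phase_ae_eq_of_isWeilGroundState {a : ℝ} {u v : ℝ → ℂ} (ha2 : a ≤ Real.log 2)
    (hu : IsWeilGroundState a u) (hv : IsWeilGroundState a v) :
    ∃ γ : ℂ, ‖γ‖ = 1 ∧ v =ᵐ[volume] fun x ↦ γ * u x := by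
  have hW : WeilWindowSimpleEven a :=
    EvenWinsBeyondArch.weilWindowSimpleEven_of_le_log_two a hu.pos ha2
  have h1 : ‖∫ t, v t * conj (u t)‖ = 1 :=
    GroundStatesConvergeToXi.norm_integral_mul_conj_eq_one_of_windowSimpleEven hW hu hv
  refine ⟨∫ t, v t * conj (u t), h1, ?_⟩
  set c : ℂ := ∫ t, v t * conj (u t) with hc
  have h0 : ∫ x, ‖v x + -c * u x‖ ^ 2 = 0 := by
    rw [ConnesVanSuijlekom.integral_norm_sq_sub_proj hv.memLp hu.memLp hu.integral_norm_sq,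
      hv.integral_norm_sq, h1]
    norm_num
  have hm : MemLp (fun x ↦ v x + -c * u x) 2 := hv.memLp.add (hu.memLp.const_mul (-c))
  have hint : Integrable (fun x ↦ ‖v x + -c * u x‖ ^ 2) :=
    (memLp_two_iff_integrable_sq_norm hm.1).1 hm
  have hae := (integral_eq_zero_iff_of_nonneg (fun x ↦ by positivity) hint).1 h0
  filter_upwards [hae] with x hx
  have hx' : ‖v x + -c * u x‖ = 0 := by
    have := hx
    simp only [Pi.zero_apply] at this
    exact pow_eq_zero_iff (n := 2) (by norm_num) |>.1 this
  rw [norm_eq_zero] at hx'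
  linear_combination hx'

/-! ## §2 The closed virial is a quadratic functional of the a.e. class -/

/-- `⟪c z, c w⟫_ℝ = |c|² ⟪z, w⟫_ℝ` on `ℂ`. [folklore] -/
theorem real_inner_const_mul (c z w : ℂ) : ⟪c * z, c * w⟫ = ‖c‖ ^ 2 * ⟪z, w⟫ := by
  simp only [Complex.inner, map_mul]
  have e : c * w * (conj c * conj z) = (c * conj c) * (w * conj z) := by ring
  rw [e, Complex.mul_conj, Complex.normSq_eq_norm_sq, Complex.re_ofReal_mul]

/-- **The pole response is quadratic**: `weilPoleResponse (c f) = |c|² weilPoleResponse f`.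
[folklore] -/
theorem weilPoleResponse_const_mul (c : ℂ) (f : ℝ → ℂ) :
    weilPoleResponse (fun x ↦ c * f x) = ‖c‖ ^ 2 * weilPoleResponse f := by
  unfold weilPoleResponse
  have e1 : ∀ k : ℝ → ℂ, (∫ x, c * f x * k x) = c * ∫ x, f x * k x := fun k ↦ by
    rw [← integral_const_mul]
    refine integral_congr_ae (Eventually.of_forall fun x ↦ ?_)
    simp only [mul_assoc]
  rw [e1 (fun x ↦ (Real.cosh (x / 2) : ℂ)), e1 (fun x ↦ (Real.sinh (x / 2) : ℂ)),
    e1 (fun x ↦ ((-(x / 2) * Real.sinh (x / 2) : ℝ) : ℂ)),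
    e1 (fun x ↦ ((-(x / 2) * Real.cosh (x / 2) : ℝ) : ℂ))]
  have e2 : ∀ A A' : ℂ, c * A' - (1 / 2 : ℂ) * (c * A) = c * (A' - (1 / 2 : ℂ) * A) :=
    fun A A' ↦ by ring
  rw [e2, e2, real_inner_const_mul, real_inner_const_mul]
  ring

/-- **The closed virial is quadratic**: `weilFormVirial (c f) = |c|² weilFormVirial f`
(pole response by `weilPoleResponse_const_mul`, archimedean virial by `weilIncrement_const_mul`).
[folklore] -/
theorem weilFormVirial_const_mul (c : ℂ) (f : ℝ → ℂ) :
    weilFormVirial (fun x ↦ c * f x) = ‖c‖ ^ 2 * weilFormVirial f := by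
  unfold weilFormVirial
  rw [weilPoleResponse_const_mul, mul_sub, ← integral_const_mul]
  congr 1
  refine integral_congr_ae (Eventually.of_forall fun s ↦ ?_)
  simp only
  rw [weilIncrement_const_mul]
  ring

/-- The pole response depends only on the a.e. class. [folklore] -/
theorem weilPoleResponse_congr_ae {f g : ℝ → ℂ} (h : f =ᵐ[volume] g) :
    weilPoleResponse f = weilPoleResponse g := by
  have e : ∀ k : ℝ → ℂ, (∫ x, f x * k x) = ∫ x, g x * k x := fun k ↦
    integral_congr_ae (by filter_upwards [h] with x hx; simp only [hx])
  unfold weilPoleResponse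
  rw [e (fun x ↦ (Real.cosh (x / 2) : ℂ)), e (fun x ↦ (Real.sinh (x / 2) : ℂ)),
    e (fun x ↦ ((-(x / 2) * Real.sinh (x / 2) : ℝ) : ℂ)),
    e (fun x ↦ ((-(x / 2) * Real.cosh (x / 2) : ℝ) : ℂ))]

/-- The closed virial depends only on the a.e. class. [folklore] -/
theorem weilFormVirial_congr_ae {f g : ℝ → ℂ} (h : f =ᵐ[volume] g) :
    weilFormVirial f = weilFormVirial g := by
  unfold weilFormVirial
  rw [weilPoleResponse_congr_ae h, weilIncrement_congr_ae h]

/-! ## §3 Equal virials, and the edge law at every small window -/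

/-- **All ground states of a window `0 < a ≤ log 2` have the same dilation virial** (they are
unimodular multiples of each other a.e., and the virial is a quadratic functional of the a.e.
class of the open-window truncation).  This DISCHARGES the hypothesis of Danskin's equality case
`hasDerivAt_weilGroundEnergy_of_virial_eq`. [cite: Kato1966, II §6.4; Danskin1966, Thm 1] -/
theorem weilSmallWindowVirial_eq_of_isWeilGroundState {a : ℝ} {u v : ℝ → ℂ}
    (ha2 : a ≤ Real.log 2) (hu : IsWeilGroundState a u) (hv : IsWeilGroundState a v) :
    weilSmallWindowVirial a u = weilSmallWindowVirial a v := by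
  obtain ⟨γ, hγ, hvu⟩ := exists_phase_ae_eq_of_isWeilGroundState ha2 hu hv
  have hae : weilTrunc a v =ᵐ[volume] fun x ↦ γ * weilTrunc a u x := by
    filter_upwards [ae_eq_weilTrunc hv, hvu, ae_eq_weilTrunc hu] with x h1 h2 h3
    rw [← h1, h2, ← h3]
  rw [weilSmallWindowVirial_eq_weilFormVirial hu.memLp,
    weilSmallWindowVirial_eq_weilFormVirial hv.memLp, weilFormVirial_congr_ae hae,
    weilFormVirial_const_mul, hγ, one_pow, one_mul]

/-- `½ log 2 < log 2` bookkeeping. [folklore] -/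
theorem le_log_two_of_lt_half {a : ℝ} (ha2 : a < Real.log 2 / 2) : a ≤ Real.log 2 := by
  have := Real.log_pos (one_lt_two)
  linarith

/-- **The Hellmann–Feynman / edge law as a two-sided derivative at EVERY small window.**  For
every window `0 < a < ½ log 2` and EVERY ground state `u` of `a`, the bottom
`ε = weilGroundEnergy` is differentiable at `a` with `ε'(a) = −V(u)/a`.  No hypothesis is left:
differentiability is a CONCLUSION (Danskin + simplicity of the bottom).
[cite: Kato1966, II §6.4 and VII §4; Danskin1966, Thm 1] -/
theorem hasDerivAt_weilGroundEnergy {a : ℝ} {u : ℝ → ℂ} (hu : IsWeilGroundState a u)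
    (ha2 : a < Real.log 2 / 2) :
    HasDerivAt weilGroundEnergy (-weilSmallWindowVirial a u / a) a :=
  hasDerivAt_weilGroundEnergy_of_virial_eq hu.pos ha2
    (fun _ _ hv hw ↦ weilSmallWindowVirial_eq_of_isWeilGroundState (le_log_two_of_lt_half ha2)
      hv hw) hu

/-- **The bottom is differentiable at every window `0 < a < ½ log 2`.** [cite: Kato1966, II §6.4] -/
theorem differentiableAt_weilGroundEnergy {a : ℝ} (ha : 0 < a) (ha2 : a < Real.log 2 / 2) :
    DifferentiableAt ℝ weilGroundEnergy a := by
  obtain ⟨u, hu⟩ := ConnesConsaniMoscovici2025_thm_3_6.exists_isWeilGroundState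
    ConnesConsaniMoscovici2025_thm_3_6_holds ha
  exact (hasDerivAt_weilGroundEnergy hu ha2).differentiableAt

/-- **`ε` is differentiable on `(0, ½ log 2)`.** [cite: Kato1966, II §6.4] -/
theorem differentiableOn_weilGroundEnergy :
    DifferentiableOn ℝ weilGroundEnergy (Ioo 0 (Real.log 2 / 2)) :=
  fun _ ha ↦ (differentiableAt_weilGroundEnergy ha.1 ha.2).differentiableWithinAt

/-- **The derivative of the bottom at a small window**: `ε'(a) = −V(u)/a` for every ground state
`u` of `a`. [cite: Danskin1966, Thm 1] -/
theorem deriv_weilGroundEnergy_eq {a : ℝ} {u : ℝ → ℂ} (hu : IsWeilGroundState a u)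
    (ha2 : a < Real.log 2 / 2) :
    deriv weilGroundEnergy a = -weilSmallWindowVirial a u / a :=
  (hasDerivAt_weilGroundEnergy hu ha2).deriv

/-- **THE EDGE LAW, unconditional form**: `a · ε'(a) = −V(u)` for every window `0 < a < ½ log 2`
and every ground state `u` of `a` (compare `mul_deriv_weilGroundEnergy_eq_neg_virial_of_lt`, which
assumed `DifferentiableAt ℝ weilGroundEnergy a`, and `ae_mul_deriv_weilGroundEnergy_eq_neg_virial`,
which held only at almost every window). [cite: Kato1966, VII §4; Danskin1966, Thm 1] -/
theorem mul_deriv_weilGroundEnergy_eq_neg_virial {a : ℝ} {u : ℝ → ℂ} (hu : IsWeilGroundState a u)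
    (ha2 : a < Real.log 2 / 2) :
    a * deriv weilGroundEnergy a = -weilSmallWindowVirial a u := by
  rw [deriv_weilGroundEnergy_eq hu ha2]
  field_simp [hu.pos.ne']

end Summit.RiemannHypothesis.RiemannHypothesis.Theorems.PfPersistence

end
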